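import Literature.NumberTheory.Transcendental.PointStep
import Literature.NumberTheory.Transcendental.BakerSiegelG
import Literature.NumberTheory.Transcendental.ThetaBaseLowerBoundG
import Mathlib.Combinatorics.Nullstellensatz
import Literature.NumberTheory.Transcendental.ExtrapolationScaled
import Literature.NumberTheory.Transcendental.NewPointsScaled
import Literature.NumberTheory.Transcendental.NumCondEnvelopes
import HarnessLib

/-!
# Baker's method on `M_κ` at a general algebraic point: the inductive step at a new point

Topic: `Literature/NumberTheory/Transcendental`. Unit
`provefact-Literature.NumberTheory.Transcendental.s-efcbe22610` (fact `semistabilityTheorem_std`).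
Verbatim port to the general-point data `BakerDataG` (`BakerFieldG.lean` and sequels) of the
corresponding `BakerData` file(s) of the torsion-point chain (see the module docstring below the
imports of those files for the mathematics); the only changes are the shapes of the arithmetic of
the point (`gBound s`, `d_s = d₁·pden s`) and of the lower bound for the base theta function
(`c·e^{−C(s+1)³}`). Everything is proved; no named facts.

## References

* A. Baker, G. Wüstholz, *Logarithmic Forms and Diophantine Geometry*, CUP 2007, §6.8 (pp. 118–119).
* A. Baker, *Transcendental Number Theory*, CUP 1975, Ch. 2, Lemmas 4–5.
-/

noncomputable section

open Complex Metric Set MvPolynomial Finset NumberField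
open scoped PeriodPair

namespace Literature.NumberTheory.Transcendental

namespace GaGmE

namespace Std

namespace BakerDataG

open BakerData (UIdx νOf νOf_apply νOf_injective degree_νOf_le wordForm_sum card_UIdx)

variable {β γ δ : Type} [Fintype β] [Fintype γ] [Fintype δ] [DecidableEq γ]
variable [DecidableEq β] [DecidableEq δ] (B : BakerDataG β γ δ)

/-- The analytic subgroup direction space `𝔟 = ⟨x_1, …, x_dd⟩`. [folklore] -/
abbrev bSpan : Submodule ℂ (β ⊕ (γ ⊕ δ) → ℂ) := Submodule.span ℂ (Set.range B.xs)

/-- The grid directions `x_c = ∑ c_m x_m`. [folklore] -/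
def gridDir (cg : Fin B.dd → ℕ) : β ⊕ (γ ⊕ δ) → ℂ := ∑ m, (cg m : ℂ) • B.xs m

omit [DecidableEq β] [DecidableEq δ] in
/-- Grid directions lie in `𝔟`. [folklore] -/
theorem gridDir_mem (cg : Fin B.dd → ℕ) : B.gridDir cg ∈ B.bSpan :=
  Submodule.sum_mem _ fun m _ => Submodule.smul_mem _ _ (Submodule.subset_span ⟨m, rfl⟩)

/-- The auxiliary form attached to `ξ`: `P = homog (nD') (QOf ξ)`. [folklore] -/
abbrev auxForm {D' : ℕ} (ξ : UIdx β γ δ D' → 𝓞 B.K) : MvPolynomial (Option β × ThetaIdx γ δ) ℂ :=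
  homog (Fintype.card (β ⊕ (γ ⊕ δ)) * D') (B.QOf ξ)

/-- **Lower levels give vanishing along `𝔟`.** If `p_{s,k'} = 0` for all `k' < k` then `F_P`
vanishes to order `≥ k` along `𝔟` at `s·v`. [folklore] -/
theorem vanishesAlong_of_levels {D' : ℕ} (ξ : UIdx β γ δ D' → 𝓞 B.K) (s : ℕ) {k : ℕ}
    (h : ∀ k' < k, B.lineValPoly ξ s k' = 0) :
    VanishesAlong B.bSpan (thetaEval B.L B.κM (B.auxForm ξ)) ((s : ℂ) • B.v) k := by
  refine vanishesAlong_span_of_wordForms B.L B.κM (isHomogeneous_homog _ _) (B.cAt s)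
    (fun x => zero_mem_chartDomain_chartChoiceAt B.L _ x) B.xs k fun k' hk' α => ?_
  have e := B.emb_coeff_lineValPoly ξ s k' (fun m => (α m : ℕ))
  rw [h k' hk', coeff_zero, map_zero] at e
  exact e.symm

/-- **The inductive step at a new point.** Let `s ∈ ℕ`, `T'`, and suppose that for every
`k < T'` and every grid direction `x_c` (`c_m ≤ k`) the extrapolation function satisfies
`|φ_{x_c,k}(s)| · |d_s|^{E} · (|d_s|^{E}·lineValBound)^{h-1} < |Θ_{J₀(c_s)}(s·v)|^D`. Then `F_P`
vanishes to order `≥ T'` along `𝔟` at `s·v`. [cite: BakerWustholz2007, §6.8 (p. 119)] -/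
theorem vanishesAlong_of_small {D' : ℕ} (ξ : UIdx β γ δ D' → 𝓞 B.K) (s T' : ℕ)
    (hφ : ∀ k < T', ∀ cg : Fin B.dd → ℕ, (∀ m, cg m ≤ k) →
      ‖extrapFun B.L B.κM (B.auxForm ξ) B.v (B.gridDir cg) k s‖ *
        (|(B.dAt s : ℝ)| ^ B.expE (Fintype.card (β ⊕ (γ ⊕ δ)) * D') k *
          (|(B.dAt s : ℝ)| ^ B.expE (Fintype.card (β ⊕ (γ ⊕ δ)) * D') k * B.lineValBound ξ s k) ^
            (B.gens.h - 1)) <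
        ‖theta B.L B.κM (baseIdx (B.cAt s)) ((s : ℂ) • B.v)‖ ^ (Fintype.card (β ⊕ (γ ⊕ δ)) * D')) :
    VanishesAlong B.bSpan (thetaEval B.L B.κM (B.auxForm ξ)) ((s : ℂ) • B.v) T' := by
  set D := Fintype.card (β ⊕ (γ ⊕ δ)) * D' with hD
  -- all levels below `T'` vanish, by strong induction
  have hlev : ∀ k < T', B.lineValPoly ξ s k = 0 := by
    intro k
    induction k using Nat.strong_induction_on with
    | _ k ih =>
      intro hk
      have hvan : VanishesAlong B.bSpan (thetaEval B.L B.κM (B.auxForm ξ)) ((s : ℂ) • B.v) k :=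
        B.vanishesAlong_of_levels ξ s fun k' hk' => ih k' hk' (hk'.trans hk)
      -- every grid value vanishes
      have hgrid : ∀ cg : Fin B.dd → ℕ, (∀ m, cg m ≤ k) →
          MvPolynomial.eval (fun m => (cg m : B.K)) (B.lineValPoly ξ s k) = 0 := by
        intro cg hcg
        have hlow : ∀ i < k, iteratedDeriv i (fun t : ℂ => thetaEval B.L B.κM (B.auxForm ξ)
            ((s : ℂ) • B.v + t • ∑ m, (cg m : ℂ) • B.xs m)) 0 = 0 :=
          fun i hi => hvan _ (B.gridDir_mem cg) i hi
        have hval := B.iteratedDeriv_grid_eq ξ s k cg hlow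
        have hsmall := hφ k hk cg hcg
        -- `φ = Θ₀^D · emb p`
        have hφeq : extrapFun B.L B.κM (B.auxForm ξ) B.v (B.gridDir cg) k s =
            theta B.L B.κM (baseIdx (B.cAt s)) ((s : ℂ) • B.v) ^ D *
              B.emb (MvPolynomial.eval (fun m => (cg m : B.K)) (B.lineValPoly ξ s k)) := hval
        rw [hφeq, norm_mul, norm_pow, mul_assoc] at hsmall
        have hΘ : 0 < ‖theta B.L B.κM (baseIdx (B.cAt s)) ((s : ℂ) • B.v)‖ ^ D := by
          obtain ⟨c, hc, C, -, hge⟩ := B.exists_theta_baseIdx_ge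
          exact pow_pos (lt_of_lt_of_le (by have := hge s; positivity) (hge s)) D
        refine B.lineVal_eq_zero_of_norm_lt ξ s k hcg ?_
        have := (mul_lt_iff_lt_one_right hΘ).mp hsmall
        rw [← hD, mul_assoc]
        exact this
      -- the grid lemma
      refine MvPolynomial.eq_zero_of_eval_zero_at_prod_finset _
        (fun _ => (Finset.range (k + 1)).image (fun j : ℕ => (j : B.K))) (fun m => ?_) (fun x hx => ?_)
      · rw [Finset.card_image_of_injective _ Nat.cast_injective, Finset.card_range]
        exact Nat.lt_succ_of_le (B.degreeOf_lineValPoly_le ξ s k m)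
      · have hx' : ∀ m, ∃ j : ℕ, j ≤ k ∧ (j : B.K) = x m := fun m => by
          obtain ⟨j, hj, hjx⟩ := Finset.mem_image.mp (hx m)
          exact ⟨j, Nat.lt_succ_iff.mp (Finset.mem_range.mp hj), hjx⟩
        choose cg hcg hcgx using hx'
        have hxe : x = fun m => (cg m : B.K) := funext fun m => (hcgx m).symm
        rw [hxe]
        exact hgrid cg hcg
  exact B.vanishesAlong_of_levels ξ s hlev


end BakerDataG

end Std

end GaGmE

end Literature.NumberTheory.Transcendental

end

/-!
# Baker's method on `M_κ` at a general algebraic point: the extrapolation estimate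

Topic: `Literature/NumberTheory/Transcendental`. Unit
`provefact-Literature.NumberTheory.Transcendental.s-efcbe22610` (fact `semistabilityTheorem_std`).
Verbatim port to the general-point data `BakerDataG` (`BakerFieldG.lean` and sequels) of the
corresponding `BakerData` file(s) of the torsion-point chain (see the module docstring below the
imports of those files for the mathematics); the only changes are the shapes of the arithmetic of
the point (`gBound s`, `d_s = d₁·pden s`) and of the lower bound for the base theta function
(`c·e^{−C(s+1)³}`). Everything is proved; no named facts.

## References

* A. Baker, G. Wüstholz, *Logarithmic Forms and Diophantine Geometry*, CUP 2007, §6.8 (pp. 118–119).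
* A. Baker, *Transcendental Number Theory*, CUP 1975, Ch. 2, Lemmas 4–5.
-/

noncomputable section

open Complex Metric Set MvPolynomial Finset NumberField
open scoped PeriodPair

namespace Literature.NumberTheory.Transcendental

namespace GaGmE

namespace Std

namespace BakerDataG

open BakerData (UIdx νOf νOf_apply νOf_injective degree_νOf_le wordForm_sum card_UIdx)

variable {β γ δ : Type} [Fintype β] [Fintype γ] [Fintype δ] [DecidableEq γ]
variable [DecidableEq β] [DecidableEq δ] (B : BakerDataG β γ δ)

/-! ### Sizes of the auxiliary form and of the grid directions -/

/-- `‖homog D (QOf ξ)‖₁ ≤ ∑_u |ξ_u|`. [folklore] -/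
theorem l1Norm_homog_QOf_le {D' : ℕ} (ξ : UIdx β γ δ D' → 𝓞 B.K) :
    Nesterenko.l1Norm (B.auxForm ξ) ≤ ∑ u, ‖B.emb ((ξ u : 𝓞 B.K) : B.K)‖ := by
  unfold Nesterenko.l1Norm auxForm
  rw [homog_QOf]
  -- `coeff_J (∑_u C a_u * m_u) = ∑_u a_u * coeff_J m_u` and `∑_J |coeff_J m_u| = 1`
  set D := Fintype.card (β ⊕ (γ ⊕ δ)) * D' with hD
  have hmon : ∀ u : UIdx β γ δ D', ∃ J : (Option β × ThetaIdx γ δ) →₀ ℕ,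
      (homogMonomialᵣ D (νOf u) : MvPolynomial (Option β × ThetaIdx γ δ) ℂ) = monomial J 1 := by
    intro u
    refine ⟨Finsupp.single (baseIdx (genericChart (γ := γ))) (D - (νOf u).degree) + (νOf u).mapDomain affIdx, ?_⟩
    rw [homogMonomialᵣ, X_pow_eq_monomial, monomial_mul, one_mul]
  choose J hJ using hmon
  have hsum : (∑ u, C (B.emb ((ξ u : 𝓞 B.K) : B.K)) * homogMonomialᵣ D (νOf u) :
      MvPolynomial (Option β × ThetaIdx γ δ) ℂ) = ∑ u, monomial (J u) (B.emb ((ξ u : 𝓞 B.K) : B.K)) := by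
    refine Finset.sum_congr rfl fun u _ => ?_
    rw [hJ u, C_mul_monomial, mul_one]
  rw [hsum]
  -- bound the ℓ¹ norm of a sum of monomials
  calc ∑ I ∈ (∑ u, monomial (J u) (B.emb ((ξ u : 𝓞 B.K) : B.K))).support,
        ‖coeff I (∑ u, monomial (J u) (B.emb ((ξ u : 𝓞 B.K) : B.K)))‖
      ≤ ∑ I ∈ (∑ u, monomial (J u) (B.emb ((ξ u : 𝓞 B.K) : B.K))).support,
          ∑ u, ‖coeff I (monomial (J u) (B.emb ((ξ u : 𝓞 B.K) : B.K)))‖ := by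
        refine Finset.sum_le_sum fun I _ => ?_
        rw [coeff_sum]
        exact norm_sum_le _ _
    _ = ∑ u, ∑ I ∈ (∑ u, monomial (J u) (B.emb ((ξ u : 𝓞 B.K) : B.K))).support,
          ‖coeff I (monomial (J u) (B.emb ((ξ u : 𝓞 B.K) : B.K)))‖ := Finset.sum_comm
    _ ≤ ∑ u, ‖B.emb ((ξ u : 𝓞 B.K) : B.K)‖ := by
        refine Finset.sum_le_sum fun u _ => ?_
        by_cases hmem : J u ∈ (∑ u, monomial (J u) (B.emb ((ξ u : 𝓞 B.K) : B.K))).support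
        · rw [← Finset.add_sum_erase _ _ hmem, coeff_monomial, if_pos rfl]
          have : ∑ I ∈ ((∑ u, monomial (J u) (B.emb ((ξ u : 𝓞 B.K) : B.K))).support).erase (J u),
              ‖coeff I (monomial (J u) (B.emb ((ξ u : 𝓞 B.K) : B.K)))‖ = 0 := by
            refine Finset.sum_eq_zero fun I hI => ?_
            rw [coeff_monomial, if_neg (Finset.ne_of_mem_erase hI).symm, norm_zero]
          rw [this, add_zero]
        · have h0 : ∑ I ∈ (∑ u, monomial (J u) (B.emb ((ξ u : 𝓞 B.K) : B.K))).support,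
              ‖coeff I (monomial (J u) (B.emb ((ξ u : 𝓞 B.K) : B.K)))‖ = 0 :=
            Finset.sum_eq_zero fun I hI => by
              rw [coeff_monomial, if_neg (fun h => hmem (by rw [h]; exact hI)), norm_zero]
          rw [h0]; exact norm_nonneg _

/-- `∑_u |ξ_u| ≤ #U · H_ξ`. [folklore] -/
theorem sum_norm_xi_le {D' : ℕ} (ξ : UIdx β γ δ D' → 𝓞 B.K) :
    ∑ u, ‖B.emb ((ξ u : 𝓞 B.K) : B.K)‖ ≤ Fintype.card (UIdx β γ δ D') * B.houseXi ξ := by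
  calc ∑ u, ‖B.emb ((ξ u : 𝓞 B.K) : B.K)‖ ≤ ∑ _u : UIdx β γ δ D', B.houseXi ξ :=
        Finset.sum_le_sum fun u _ => B.norm_embedding_xi_le ξ B.emb u
    _ = Fintype.card (UIdx β γ δ D') * B.houseXi ξ := by rw [Finset.sum_const, nsmul_eq_mul, Finset.card_univ]

/-- The size of the directions `X = ∑_m ‖x_m‖`. [folklore] -/
def dirNorm : ℝ := ∑ m, ‖B.xs m‖

omit [DecidableEq β] [DecidableEq δ] in
/-- `0 ≤ X`. [folklore] -/
theorem dirNorm_nonneg : 0 ≤ B.dirNorm := Finset.sum_nonneg fun _ _ => norm_nonneg _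

omit [DecidableEq β] [DecidableEq δ] in
/-- `‖x_c‖ ≤ k · X` for `c_m ≤ k`. [folklore] -/
theorem norm_gridDir_le {k : ℕ} {cg : Fin B.dd → ℕ} (hcg : ∀ m, cg m ≤ k) :
    ‖B.gridDir cg‖ ≤ k * B.dirNorm := by
  unfold gridDir dirNorm
  rw [Finset.mul_sum]
  refine (norm_sum_le _ _).trans (Finset.sum_le_sum fun m _ => ?_)
  rw [norm_smul, Complex.norm_natCast]
  exact mul_le_mul_of_nonneg_right (by exact_mod_cast hcg m) (norm_nonneg _)


/-! ### The extrapolation estimate (scaled radius) -/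

/-- **The extrapolation estimate with scaled radius** (`r = 1/(kX + 1)`): for `v ∈ 𝔟`,
vanishing to order `≥ T` along `𝔟` at `0, …, S₀v`, `c_m ≤ k`, `R ≥ 2(s + S₀)`, `R > 0`:
`|φ_{x_c,k}(s)| ≤ k!·(kX+1)^k·#U·H_ξ·e^{C(1+(R‖v‖+1)²)·D}·(2(s+S₀)/R)^{(T-k)(S₀+1)}`.
[cite: Baker1975, Ch. 2 Lemma 4; BakerWustholz2007, §6.8 (p. 119)] -/
theorem norm_extrapFun_grid_le₂ {C : ℝ} (hC0 : 0 ≤ C)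
    (hC : ∀ (J : Option β × ThetaIdx γ δ) (w : β ⊕ (γ ⊕ δ) → ℂ),
      ‖theta B.L B.κM J w‖ ≤ Real.exp (C * (1 + ‖w‖ ^ 2)))
    (hv : B.v ∈ B.bSpan) {D' : ℕ} (ξ : UIdx β γ δ D' → 𝓞 B.K) {T S₀ : ℕ}
    (hvan : ∀ s₀ : ℕ, s₀ ≤ S₀ → VanishesAlong B.bSpan (thetaEval B.L B.κM (B.auxForm ξ)) ((s₀ : ℂ) • B.v) T)
    {k : ℕ} {cg : Fin B.dd → ℕ} (hcg : ∀ m, cg m ≤ k) (s : ℕ) {R : ℝ} (hR0 : 0 < R)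
    (hR : 2 * ((s : ℝ) + S₀) ≤ R) :
    ‖extrapFun B.L B.κM (B.auxForm ξ) B.v (B.gridDir cg) k s‖ ≤
      k.factorial * ((k : ℝ) * B.dirNorm + 1) ^ k * (Fintype.card (UIdx β γ δ D') * B.houseXi ξ *
        Real.exp (C * (1 + (R * ‖B.v‖ + 1) ^ 2)) ^ (Fintype.card (β ⊕ (γ ⊕ δ)) * D')) *
        (2 * ((s : ℝ) + S₀) / R) ^ ((T - k) * (S₀ + 1)) := by
  set D := Fintype.card (β ⊕ (γ ⊕ δ)) * D' with hD
  set f := extrapFun B.L B.κM (B.auxForm ξ) B.v (B.gridDir cg) k with hf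
  set r : ℝ := 1 / ((k : ℝ) * B.dirNorm + 1) with hr
  have hX0 := B.dirNorm_nonneg
  have hr0 : 0 < r := by rw [hr]; positivity
  have hrx : r * ‖B.gridDir cg‖ ≤ 1 := by
    have hX := B.norm_gridDir_le hcg
    rw [hr, one_div, inv_mul_le_iff₀ (by positivity)]
    linarith
  set pts : Finset ℂ := (Finset.range (S₀ + 1)).image (fun j : ℕ => (j : ℂ)) with hpts
  have hcard : pts.card = S₀ + 1 := by
    rw [hpts, Finset.card_image_of_injective _ Nat.cast_injective, Finset.card_range]
  have hdiff : Differentiable ℂ f := differentiable_extrapFun B.L B.κM _ _ _ k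
  have hord : ∀ c ∈ pts, ((T - k : ℕ) : ℕ∞) ≤ analyticOrderAt f c := by
    intro c hc
    obtain ⟨j, hj, rfl⟩ := Finset.mem_image.mp hc
    have hjS : j ≤ S₀ := Nat.lt_succ_iff.mp (Finset.mem_range.mp hj)
    exact le_analyticOrderAt_extrapFun B.L B.κM _ hv (B.gridDir_mem cg) (hvan j hjS) k
  -- the bound on the circle `|z| = R` with Cauchy radius `r` in `ξ`
  set θ : ℝ := k.factorial * (Nesterenko.l1Norm (B.auxForm ξ) *
    Real.exp (C * (1 + (R * ‖B.v‖ + 1) ^ 2)) ^ D) / r ^ k with hθ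
  have hθb : ∀ z ∈ sphere (0 : ℂ) R, ‖f z‖ ≤ θ := by
    intro z hz
    have hzR : ‖z‖ = R := by simpa using hz
    have h := norm_extrapFun_le_radius B.L B.κM hC0 hC (P := B.auxForm ξ) (D := D)
      ((isHomogeneous_homog D (B.QOf ξ)).totalDegree_le) B.v (B.gridDir cg) k z hr0
    rw [hzR] at h
    refine h.trans ?_
    rw [hθ]
    refine div_le_div_of_nonneg_right (mul_le_mul_of_nonneg_left (mul_le_mul_of_nonneg_left
      (pow_le_pow_left₀ (Real.exp_nonneg _) (Real.exp_le_exp.mpr (mul_le_mul_of_nonneg_left ?_ hC0)) D)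
      (Nesterenko.l1Norm_nonneg _)) (Nat.cast_nonneg _)) (pow_nonneg hr0.le _)
    have h1 : 0 ≤ R * ‖B.v‖ + r * ‖B.gridDir cg‖ := by positivity
    nlinarith
  -- separation and products as in `norm_extrapFun_grid_le`
  have hsep : ∀ z ∈ sphere (0 : ℂ) R, ∀ c ∈ pts, R / 2 ≤ ‖z - c‖ := by
    intro z hz c hc
    have hzR : ‖z‖ = R := by simpa using hz
    obtain ⟨j, hj, rfl⟩ := Finset.mem_image.mp hc
    have hjS : (j : ℝ) ≤ S₀ := by exact_mod_cast Nat.lt_succ_iff.mp (Finset.mem_range.mp hj)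
    have h1 : ‖z‖ - ‖(j : ℂ)‖ ≤ ‖z - (j : ℂ)‖ := norm_sub_norm_le z j
    rw [hzR, Complex.norm_natCast] at h1
    have hs0 : (0 : ℝ) ≤ s := Nat.cast_nonneg s
    linarith
  have hm : (0 : ℝ) < (R / 2) ^ ((T - k) * pts.card) := pow_pos (by linarith) _
  have hmF : ∀ z ∈ sphere (0 : ℂ) R, (R / 2) ^ ((T - k) * pts.card) ≤ ‖∏ c ∈ pts, (z - c) ^ (T - k)‖ :=
    fun z hz => Baker1975.Analytic.le_norm_prod_pow pts (T - k) (by linarith) (hsep z hz)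
  have hsR : ‖(s : ℂ)‖ ≤ R := by
    rw [Complex.norm_natCast]
    have : (0 : ℝ) ≤ S₀ := Nat.cast_nonneg S₀
    have hs0 : (0 : ℝ) ≤ s := Nat.cast_nonneg s
    linarith
  have hmain := Baker1975.Analytic.norm_le_of_analyticOrderAt hdiff pts (T - k) hord hR0 hθb hm hmF hsR
  have hup : ‖∏ c ∈ pts, ((s : ℂ) - c) ^ (T - k)‖ ≤ ((s : ℝ) + S₀) ^ ((T - k) * pts.card) := by
    refine Baker1975.Analytic.norm_prod_pow_le pts (T - k) fun c hc => ?_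
    obtain ⟨j, hj, rfl⟩ := Finset.mem_image.mp hc
    have hjS : (j : ℝ) ≤ S₀ := by exact_mod_cast Nat.lt_succ_iff.mp (Finset.mem_range.mp hj)
    calc ‖(s : ℂ) - (j : ℂ)‖ ≤ ‖(s : ℂ)‖ + ‖(j : ℂ)‖ := norm_sub_le _ _
      _ = s + j := by rw [Complex.norm_natCast, Complex.norm_natCast]
      _ ≤ s + S₀ := by linarith
  rw [hcard] at hm hup hmain
  have hθ0 : 0 ≤ θ := by
    rw [hθ]; have := Nesterenko.l1Norm_nonneg (B.auxForm ξ); positivity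
  have step1 : ‖f s‖ ≤ θ * (2 * ((s : ℝ) + S₀) / R) ^ ((T - k) * (S₀ + 1)) := by
    refine hmain.trans ?_
    have e : θ / (R / 2) ^ ((T - k) * (S₀ + 1)) * ((s : ℝ) + S₀) ^ ((T - k) * (S₀ + 1)) =
        θ * (2 * ((s : ℝ) + S₀) / R) ^ ((T - k) * (S₀ + 1)) := by
      rw [show 2 * ((s : ℝ) + S₀) / R = (2 / R) * ((s : ℝ) + S₀) from by ring, mul_pow, div_pow, div_pow]
      field_simp
    rw [← e]
    exact mul_le_mul_of_nonneg_left hup (div_nonneg hθ0 hm.le)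
  refine step1.trans (mul_le_mul_of_nonneg_right ?_ (by positivity))
  -- `θ ≤ k!·(kX+1)^k·#U·H_ξ·e^{…}`
  rw [hθ, hr, one_div, inv_pow, div_eq_mul_inv, inv_inv]
  have hcoeff := (B.l1Norm_homog_QOf_le ξ).trans (B.sum_norm_xi_le ξ)
  have hHξ := B.one_le_houseXi ξ
  have hE0 : 0 ≤ Real.exp (C * (1 + (R * ‖B.v‖ + 1) ^ 2)) ^ D := pow_nonneg (Real.exp_nonneg _) _
  have hkX : 0 ≤ ((k : ℝ) * B.dirNorm + 1) ^ k := by positivity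
  calc (k.factorial : ℝ) * (Nesterenko.l1Norm (B.auxForm ξ) * Real.exp (C * (1 + (R * ‖B.v‖ + 1) ^ 2)) ^ D) *
        ((k : ℝ) * B.dirNorm + 1) ^ k
      ≤ (k.factorial : ℝ) * ((Fintype.card (UIdx β γ δ D') * B.houseXi ξ) *
          Real.exp (C * (1 + (R * ‖B.v‖ + 1) ^ 2)) ^ D) * ((k : ℝ) * B.dirNorm + 1) ^ k := by
        refine mul_le_mul_of_nonneg_right (mul_le_mul_of_nonneg_left
          (mul_le_mul_of_nonneg_right hcoeff hE0) (Nat.cast_nonneg _)) hkX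
    _ = _ := by ring


end BakerDataG

end Std

end GaGmE

end Literature.NumberTheory.Transcendental

end

/-!
# Baker's method on `M_κ` at a general algebraic point: vanishing at the new points and the engine

Topic: `Literature/NumberTheory/Transcendental`. Unit
`provefact-Literature.NumberTheory.Transcendental.s-efcbe22610` (fact `semistabilityTheorem_std`).
Verbatim port to the general-point data `BakerDataG` (`BakerFieldG.lean` and sequels) of the
corresponding `BakerData` file(s) of the torsion-point chain (see the module docstring below the
imports of those files for the mathematics); the only changes are the shapes of the arithmetic of
the point (`gBound s`, `d_s = d₁·pden s`) and of the lower bound for the base theta function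
(`c·e^{−C(s+1)³}`). Everything is proved; no named facts.

## References

* A. Baker, G. Wüstholz, *Logarithmic Forms and Diophantine Geometry*, CUP 2007, §6.8 (pp. 118–119).
* A. Baker, *Transcendental Number Theory*, CUP 1975, Ch. 2, Lemmas 4–5.
-/

noncomputable section

open Complex Metric Set MvPolynomial Finset NumberField
open scoped PeriodPair

namespace Literature.NumberTheory.Transcendental

namespace GaGmE

namespace Std

namespace BakerDataG

open BakerData (UIdx νOf νOf_apply νOf_injective degree_νOf_le wordForm_sum card_UIdx)

variable {β γ δ : Type} [Fintype β] [Fintype γ] [Fintype δ] [DecidableEq γ]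
variable [DecidableEq β] [DecidableEq δ] (B : BakerDataG β γ δ)

/-! ### The constants of the lower bound -/

omit [DecidableEq β] [DecidableEq δ] in
/-- The lower bound for the base theta function at `s·v`, in terms of the adapted chart `cAt s`.
[cite: BakerWustholz2007, §6.8 (p. 119)] -/
theorem exists_theta_baseIdx_cAt_ge : ∃ c : ℝ, 0 < c ∧ ∃ C : ℝ, 0 ≤ C ∧ ∀ s : ℕ,
    c * Real.exp (-(C * ((s : ℝ) + 1) ^ 3)) ≤ ‖theta B.L B.κM (baseIdx (B.cAt s)) ((s : ℂ) • B.v)‖ :=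
  B.exists_theta_baseIdx_ge

/-- **The constant `c_Θ > 0`** of the lower bound `c_Θ e^{-C'_Θ(s+1)³} ≤ |Θ_{J₀(c_s)}(s·v)|`. [folklore] -/
def thetaLowc : ℝ := B.exists_theta_baseIdx_cAt_ge.choose

/-- **The constant `C'_Θ ≥ 0`** of the lower bound. [folklore] -/
def thetaLowC : ℝ := B.exists_theta_baseIdx_cAt_ge.choose_spec.2.choose

omit [DecidableEq β] [DecidableEq δ] in
/-- The defining properties of `c_Θ, C'_Θ`. [folklore] -/
theorem thetaLow_spec : 0 < B.thetaLowc ∧ 0 ≤ B.thetaLowC ∧ ∀ s : ℕ,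
    B.thetaLowc * Real.exp (-(B.thetaLowC * ((s : ℝ) + 1) ^ 3)) ≤
      ‖theta B.L B.κM (baseIdx (B.cAt s)) ((s : ℂ) • B.v)‖ :=
  ⟨B.exists_theta_baseIdx_cAt_ge.choose_spec.1, B.exists_theta_baseIdx_cAt_ge.choose_spec.2.choose_spec.1,
    B.exists_theta_baseIdx_cAt_ge.choose_spec.2.choose_spec.2⟩

/-! ### The numerical condition and the vanishing at the new points -/

/-- **The numerical condition (scaled form)**: for all `s ≤ S₁`, `k < T'`,
`k!·(kX+1)^k·#U·H_ξ·e^{C_Θ(1+(R‖v‖+1)²)·D}·(2(s+S₀)/R)^{(T-k)(S₀+1)} · |d_s|^E (|d_s|^E Λ_{s,k})^{h-1}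
  < (c_Θ e^{-C'_Θ(s+1)³})^{D}` (`D = nD'`). [folklore] -/
def NumCond₂ {D' : ℕ} (ξ : UIdx β γ δ D' → 𝓞 B.K) (T S₀ S₁ T' : ℕ) (R : ℝ) : Prop :=
  ∀ s : ℕ, s ≤ S₁ → ∀ k : ℕ, k < T' →
    (k.factorial : ℝ) * ((k : ℝ) * B.dirNorm + 1) ^ k * (Fintype.card (UIdx β γ δ D') * B.houseXi ξ *
        Real.exp (thetaGrowthC (β := β) B.L B.κM * (1 + (R * ‖B.v‖ + 1) ^ 2)) ^
          (Fintype.card (β ⊕ (γ ⊕ δ)) * D')) *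
      (2 * ((s : ℝ) + S₀) / R) ^ ((T - k) * (S₀ + 1)) *
      (|(B.dAt s : ℝ)| ^ B.expE (Fintype.card (β ⊕ (γ ⊕ δ)) * D') k *
        (|(B.dAt s : ℝ)| ^ B.expE (Fintype.card (β ⊕ (γ ⊕ δ)) * D') k * B.lineValBound ξ s k) ^
          (B.gens.h - 1)) <
    (B.thetaLowc * Real.exp (-(B.thetaLowC * ((s : ℝ) + 1) ^ 3))) ^ (Fintype.card (β ⊕ (γ ⊕ δ)) * D')

/-- **Vanishing at the new points (scaled form).** [cite: BakerWustholz2007, §6.8 (p. 119)] -/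
theorem vanishesAlong_newPoints₂ (hv : B.v ∈ B.bSpan) {D' : ℕ} (ξ : UIdx β γ δ D' → 𝓞 B.K)
    {T S₀ S₁ T' : ℕ} {R : ℝ} (hR0 : 0 < R) (hR : 2 * ((S₁ : ℝ) + S₀) ≤ R)
    (hvan : ∀ s₀ : ℕ, s₀ ≤ S₀ → VanishesAlong B.bSpan (thetaEval B.L B.κM (B.auxForm ξ)) ((s₀ : ℂ) • B.v) T)
    (hnum : B.NumCond₂ ξ T S₀ S₁ T' R) {s : ℕ} (hs : s ≤ S₁) :
    VanishesAlong B.bSpan (thetaEval B.L B.κM (B.auxForm ξ)) ((s : ℂ) • B.v) T' := by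
  obtain ⟨hC0, hC⟩ := thetaGrowthC_spec (β := β) B.L B.κM
  obtain ⟨hc0, hC'0, hlow⟩ := B.thetaLow_spec
  refine B.vanishesAlong_of_small ξ s T' fun k hk cg hcg => ?_
  have hRs : 2 * ((s : ℝ) + S₀) ≤ R := by
    have : (s : ℝ) ≤ S₁ := by exact_mod_cast hs
    linarith
  have hφ := B.norm_extrapFun_grid_le₂ hC0 hC hv ξ hvan hcg s hR0 hRs
  have hΛ : 0 ≤ |(B.dAt s : ℝ)| ^ B.expE (Fintype.card (β ⊕ (γ ⊕ δ)) * D') k *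
      (|(B.dAt s : ℝ)| ^ B.expE (Fintype.card (β ⊕ (γ ⊕ δ)) * D') k * B.lineValBound ξ s k) ^ (B.gens.h - 1) := by
    have := B.lineValBound_nonneg ξ s k
    positivity
  have hΘ : (B.thetaLowc * Real.exp (-(B.thetaLowC * ((s : ℝ) + 1) ^ 3))) ^ (Fintype.card (β ⊕ (γ ⊕ δ)) * D') ≤
      ‖theta B.L B.κM (baseIdx (B.cAt s)) ((s : ℂ) • B.v)‖ ^ (Fintype.card (β ⊕ (γ ⊕ δ)) * D') :=
    pow_le_pow_left₀ (by positivity) (hlow s) _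
  calc ‖extrapFun B.L B.κM (B.auxForm ξ) B.v (B.gridDir cg) k s‖ *
        (|(B.dAt s : ℝ)| ^ B.expE (Fintype.card (β ⊕ (γ ⊕ δ)) * D') k *
          (|(B.dAt s : ℝ)| ^ B.expE (Fintype.card (β ⊕ (γ ⊕ δ)) * D') k * B.lineValBound ξ s k) ^ (B.gens.h - 1))
      ≤ _ := mul_le_mul_of_nonneg_right hφ hΛ
    _ < _ := hnum s hs k hk
    _ ≤ _ := hΘ

/-- The Siegel house bound for the coefficients `ξ_u` (`SiegelWrapper.siegelConst`). [folklore] -/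
def siegelHouseBound (D' T S₀ : ℕ) : ℝ :=
  siegelConst B.K * (siegelConst B.K * ((D' + 1) ^ Fintype.card (β ⊕ (γ ⊕ δ)) : ℕ) * B.houseBound D' T S₀) ^
    ((((S₀ + 1) * T ^ B.dd : ℕ) : ℝ) /
      ((((D' + 1) ^ Fintype.card (β ⊕ (γ ⊕ δ)) : ℕ) : ℝ) - ((S₀ + 1) * T ^ B.dd : ℕ)))

/-- **The Baker engine (scaled form).** `v ∈ 𝔟`, `T ≥ 1`, `(S₀+1)·T^{dd} < (D'+1)^n`, `R > 0`,
`R ≥ 2(S₁ + S₀)`, and `NumCond₂` for every coefficient vector within the Siegel house bound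
`⇒ ∃ P` homogeneous of degree `nD'`, `F_P ≢ 0`, `VanishesAlong 𝔟 F_P (s·v) T'` for `s ≤ S₁`.
[cite: BakerWustholz2007, §6.8 (pp. 118–119)] -/
theorem engine₂ (hv : B.v ∈ B.bSpan) (D' T S₀ S₁ T' : ℕ) (R : ℝ) (hT : 0 < T)
    (hpq : (S₀ + 1) * T ^ B.dd < (D' + 1) ^ Fintype.card (β ⊕ (γ ⊕ δ)))
    (hR0 : 0 < R) (hR : 2 * ((S₁ : ℝ) + S₀) ≤ R)
    (hnum : ∀ ξ : UIdx β γ δ D' → 𝓞 B.K,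
      (∀ u, house ((ξ u : 𝓞 B.K) : B.K) ≤ B.siegelHouseBound D' T S₀) → B.NumCond₂ ξ T S₀ S₁ T' R) :
    ∃ P : MvPolynomial (Option β × ThetaIdx γ δ) ℂ,
      P.IsHomogeneous (Fintype.card (β ⊕ (γ ⊕ δ)) * D') ∧
      (∃ w, thetaEval B.L B.κM P w ≠ 0) ∧
      ∀ s : ℕ, s ≤ S₁ → VanishesAlong B.bSpan (thetaEval B.L B.κM P) ((s : ℂ) • B.v) T' := by
  obtain ⟨ξ, -, hhouse, hne, hvan⟩ := B.exists_auxiliary₂ D' T S₀ hT hpq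
  refine ⟨B.auxForm ξ, isHomogeneous_homog _ _, hne, fun s hs => ?_⟩
  exact B.vanishesAlong_newPoints₂ hv ξ hR0 hR (fun s₀ hs₀ => hvan s₀ hs₀) (hnum ξ hhouse) hs


end BakerDataG

end Std

end GaGmE

end Literature.NumberTheory.Transcendental

end

/-!
# Two-base envelopes for the numerical condition at a general algebraic point

Topic: `Literature/NumberTheory/Transcendental`. Unit
`provefact-Literature.NumberTheory.Transcendental.s-efcbe22610` (fact `semistabilityTheorem_std`).
`NumCondEnvelopes.lean` for the general-point data `BakerDataG`: every factor of the left-hand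
side of `NewPointsG.NumCond₂` is bounded by `G^{N₁} · W^{N₂}` with natural exponents, where
`G = bigConst` dominates all constants of the datum (now including the base `Mg` of the conjugate
bounds `gBound s = Mg^{(s+1)³}`) and `W ≥ 1` the linear sizes. Compared with the torsion-point
file the `s`-dependence is cubic: `gBound s ≤ G^{(s+1)³}`, `dB s ≤ G^{1 + #Gen·(s+1)³}`
(`houseBound_le`, `dAt_pow_le`, `lineValBound_le`) and `G^{-D(1+(s+1)³)} ≤ (c_Θ e^{-C'_Θ(s+1)³})^D`
(`rhs_ge`); `siegelHouseBound_le`, `houseXi_le`, `orderLoss_le`, `growth_le` are verbatim and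
the generic `BakerData.saving_le`, `BakerData.rpow_le_self_of_one_le` are reused.
Everything is proved; no named facts.

## References

* A. Baker, G. Wüstholz, *Logarithmic Forms and Diophantine Geometry*, CUP 2007, §6.8 (p. 119).
-/

noncomputable section

open Complex MvPolynomial Finset NumberField
open scoped PeriodPair

namespace Literature.NumberTheory.Transcendental

namespace GaGmE

namespace Std

namespace BakerDataG

open BakerData (UIdx νOf νOf_apply νOf_injective degree_νOf_le card_UIdx)

variable {β γ δ : Type} [Fintype β] [Fintype γ] [Fintype δ] [DecidableEq γ]
variable (B : BakerDataG β γ δ)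

/-! ### The big constant -/

/-- **The big constant** `G ≥ 2` dominating every constant of the datum that enters `NumCond₂`.
[folklore] -/
def bigConst : ℝ :=
  2 + |(B.d₁ : ℝ)| + B.Mg + B.hB + max 1 B.qB + ((B.dd : ℝ) + 1) + siegelConst B.K +
    Real.exp (thetaGrowthC (β := β) B.L B.κM) + B.thetaLowc⁻¹ + Real.exp B.thetaLowC +
    (B.dirNorm + 1) + (‖B.v‖ + 1)

/-- The summands of `G` are non-negative; `G` dominates each of them and `G ≥ 2`. [folklore] -/
theorem bigConst_spec :
    2 ≤ B.bigConst ∧ |(B.d₁ : ℝ)| ≤ B.bigConst ∧ B.Mg ≤ B.bigConst ∧ B.hB ≤ B.bigConst ∧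
    max 1 B.qB ≤ B.bigConst ∧ (B.dd : ℝ) + 1 ≤ B.bigConst ∧ siegelConst B.K ≤ B.bigConst ∧
    Real.exp (thetaGrowthC (β := β) B.L B.κM) ≤ B.bigConst ∧ B.thetaLowc⁻¹ ≤ B.bigConst ∧
    Real.exp B.thetaLowC ≤ B.bigConst ∧ B.dirNorm + 1 ≤ B.bigConst ∧ ‖B.v‖ + 1 ≤ B.bigConst := by
  have h1 : 0 ≤ |(B.d₁ : ℝ)| := abs_nonneg _
  have h2 : 0 ≤ B.Mg := zero_le_one.trans B.one_le_Mg
  have h3 : 0 ≤ B.hB := zero_le_one.trans B.one_le_hB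
  have h4 : 0 ≤ max 1 B.qB := zero_le_one.trans (le_max_left _ _)
  have h5 : 0 ≤ (B.dd : ℝ) + 1 := by positivity
  have h6 : 0 ≤ siegelConst B.K := zero_le_one.trans (one_le_siegelConst B.K)
  have h7 : 0 ≤ Real.exp (thetaGrowthC (β := β) B.L B.κM) := Real.exp_nonneg _
  have h8 : 0 ≤ B.thetaLowc⁻¹ := inv_nonneg.mpr B.thetaLow_spec.1.le
  have h9 : 0 ≤ Real.exp B.thetaLowC := Real.exp_nonneg _
  have h10 : 0 ≤ B.dirNorm + 1 := by have := B.dirNorm_nonneg; positivity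
  have h11 : 0 ≤ ‖B.v‖ + 1 := by positivity
  unfold bigConst
  refine ⟨?_, ?_, ?_, ?_, ?_, ?_, ?_, ?_, ?_, ?_, ?_, ?_⟩ <;> linarith

/-- `1 ≤ G`. [folklore] -/
theorem one_le_bigConst : 1 ≤ B.bigConst := by have := B.bigConst_spec.1; linarith

/-! ### Elementary envelope tools -/

/-- `x^N ≤ G^N` for `0 ≤ x ≤ G`. [folklore] -/
theorem pow_le_bigConst_pow {x : ℝ} (hx0 : 0 ≤ x) (hx : x ≤ B.bigConst) (N : ℕ) : x ^ N ≤ B.bigConst ^ N :=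
  pow_le_pow_left₀ hx0 hx N

/-- Monotonicity in the exponent: `G^N ≤ G^{N'}` for `N ≤ N'`. [folklore] -/
theorem bigConst_pow_mono {N N' : ℕ} (h : N ≤ N') : B.bigConst ^ N ≤ B.bigConst ^ N' :=
  pow_le_pow_right₀ B.one_le_bigConst h

/-- `exp(C·y) ≤ G^N` when `e^C ≤ G`, `0 ≤ y ≤ N`. [folklore] -/
theorem exp_mul_le_bigConst_pow {C y : ℝ} (hC : Real.exp C ≤ B.bigConst) (hC0 : 0 ≤ C)
    {N : ℕ} (hy : y ≤ N) : Real.exp (C * y) ≤ B.bigConst ^ N := by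
  have hG := B.one_le_bigConst
  calc Real.exp (C * y) ≤ Real.exp (C * N) := Real.exp_le_exp.mpr (mul_le_mul_of_nonneg_left hy hC0)
    _ = Real.exp C ^ N := by rw [← Real.exp_nat_mul, mul_comm]
    _ ≤ B.bigConst ^ N := pow_le_pow_left₀ (Real.exp_nonneg _) hC N

/-! ### The house bound -/

/-- `gBound s ≤ G^{(s+1)³}`. [folklore] -/
theorem gBound_le_pow (s : ℕ) : B.gBound s ≤ B.bigConst ^ ((s + 1) ^ 3) :=
  pow_le_pow_left₀ (zero_le_one.trans B.one_le_Mg) B.bigConst_spec.2.2.1 _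

/-- `dB s ≤ G^{1 + #Gen·(s+1)³}`. [folklore] -/
theorem dB_le_pow (s : ℕ) : B.dB s ≤ B.bigConst ^ (1 + Fintype.card (Gen β γ δ) * (s + 1) ^ 3) := by
  obtain ⟨hG2, hd1, -⟩ := B.bigConst_spec
  unfold dB
  rw [pow_add, pow_one, pow_mul]
  have h0 : (0 : ℝ) ≤ B.gBound s ^ Fintype.card (Gen β γ δ) := pow_nonneg (zero_le_one.trans (B.one_le_gBound s)) _
  refine mul_le_mul hd1 ?_ h0 (by linarith)
  rw [← pow_mul, mul_comm, pow_mul]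
  exact pow_le_pow_left₀ (zero_le_one.trans (B.one_le_gBound s)) (B.gBound_le_pow s) _

/-- **Envelope of `houseBound`**: with `D = nD'`, `E_T = expE D T`, `c = #Gen`,
`A ≤ G^{(1 + c(S₀+1)³)E_T + 2T + D + (S₀+1)³(D·hdeg + 2T)} · W^{T}`
whenever `D·hdeg + 2T + 1 ≤ W`. [folklore] -/
theorem houseBound_le (D' T S₀ : ℕ) {W : ℝ} (hW1 : 1 ≤ W)
    (hWT : ((Fintype.card (β ⊕ (γ ⊕ δ)) * D' * B.hdeg : ℕ) : ℝ) + 2 * T + 1 ≤ W) :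
    B.houseBound D' T S₀ ≤
      B.bigConst ^ ((1 + Fintype.card (Gen β γ δ) * (S₀ + 1) ^ 3) * B.expE (Fintype.card (β ⊕ (γ ⊕ δ)) * D') T + 2 * T +
          Fintype.card (β ⊕ (γ ⊕ δ)) * D' +
          (S₀ + 1) ^ 3 * (Fintype.card (β ⊕ (γ ⊕ δ)) * D' * B.hdeg + 2 * T)) *
        W ^ T := by
  obtain ⟨hG2, hd1, hM, hhB, hqB, hdd, -⟩ := B.bigConst_spec
  have hG1 := B.one_le_bigConst
  set n := Fintype.card (β ⊕ (γ ⊕ δ)) with hn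
  set cG := Fintype.card (Gen β γ δ) with hcG
  set D := n * D' with hD
  set ET := B.expE D T with hET
  set P := D * B.hdeg + 2 * T with hP
  unfold houseBound
  rw [← hn, ← hD, ← hET]
  have hG0 : (0 : ℝ) ≤ B.bigConst := by linarith
  have hW0 : (0 : ℝ) ≤ W := by linarith
  have hdB1 := B.one_le_dB S₀
  have hgB1 := B.one_le_gBound S₀
  -- factor by factor
  have f1 : B.dB S₀ ^ ET ≤ (B.bigConst ^ (1 + cG * (S₀ + 1) ^ 3)) ^ ET :=
    pow_le_pow_left₀ (zero_le_one.trans hdB1) (B.dB_le_pow S₀) _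
  have f2 : ((B.dd : ℝ) + 1) ^ T ≤ B.bigConst ^ T := pow_le_pow_left₀ (by positivity) hdd _
  have f3 : (((D * B.hdeg : ℕ) : ℝ) + 2 * T + 1) ^ T ≤ W ^ T := pow_le_pow_left₀ (by positivity) hWT _
  have f4 : (max 1 B.qB) ^ T ≤ B.bigConst ^ T := pow_le_pow_left₀ (zero_le_one.trans (le_max_left _ _)) hqB _
  have f5 : B.hB ^ D ≤ B.bigConst ^ D := pow_le_pow_left₀ (zero_le_one.trans B.one_le_hB) hhB _
  have f6 : B.gBound S₀ ^ P ≤ (B.bigConst ^ ((S₀ + 1) ^ 3)) ^ P :=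
    pow_le_pow_left₀ (zero_le_one.trans hgB1) (B.gBound_le_pow S₀) _
  have n2 : (0 : ℝ) ≤ ((B.dd : ℝ) + 1) ^ T := by positivity
  have n3 : (0 : ℝ) ≤ (((D * B.hdeg : ℕ) : ℝ) + 2 * T + 1) ^ T := by positivity
  have n4 : (0 : ℝ) ≤ (max 1 B.qB) ^ T := pow_nonneg (zero_le_one.trans (le_max_left _ _)) _
  have n5 : (0 : ℝ) ≤ B.hB ^ D := pow_nonneg (zero_le_one.trans B.one_le_hB) _
  have n6 : (0 : ℝ) ≤ B.gBound S₀ ^ P := pow_nonneg (zero_le_one.trans hgB1) _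
  have b1 : (0 : ℝ) ≤ (B.bigConst ^ (1 + cG * (S₀ + 1) ^ 3)) ^ ET := by positivity
  calc B.dB S₀ ^ ET * ((B.dd : ℝ) + 1) ^ T * (((D * B.hdeg : ℕ) : ℝ) + 2 * T + 1) ^ T *
        (max 1 B.qB) ^ T * B.hB ^ D * B.gBound S₀ ^ P
      ≤ (B.bigConst ^ (1 + cG * (S₀ + 1) ^ 3)) ^ ET * B.bigConst ^ T * W ^ T * B.bigConst ^ T * B.bigConst ^ D *
          (B.bigConst ^ ((S₀ + 1) ^ 3)) ^ P :=
        mul_le_mul (mul_le_mul (mul_le_mul (mul_le_mul (mul_le_mul f1 f2 n2 b1) f3 n3 (by positivity)) f4 n4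
          (by positivity)) f5 n5 (by positivity)) f6 n6 (by positivity)
    _ = B.bigConst ^ ((1 + cG * (S₀ + 1) ^ 3) * ET + 2 * T + D + (S₀ + 1) ^ 3 * P) * W ^ T := by
        rw [← pow_mul, ← pow_mul]; ring

/-! ### The Siegel house bound and `H_ξ` -/

/-- **Envelope of the Siegel house bound** when `q ≥ 2p` (so the Siegel exponent is `≤ 1`):
`siegelHouseBound ≤ G² · W^n · A`, `A = houseBound`, given `(D'+1)^n ≤ W^n`-type control
`D' + 1 ≤ W`. [folklore] -/
theorem siegelHouseBound_le (D' T S₀ : ℕ) {W : ℝ} (hWD : (D' : ℝ) + 1 ≤ W)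
    (hqp : 2 * ((S₀ + 1) * T ^ B.dd) ≤ (D' + 1) ^ Fintype.card (β ⊕ (γ ⊕ δ))) (hp : 0 < (S₀ + 1) * T ^ B.dd) :
    B.siegelHouseBound D' T S₀ ≤ B.bigConst ^ 2 * W ^ Fintype.card (β ⊕ (γ ⊕ δ)) * B.houseBound D' T S₀ := by
  obtain ⟨hG2, -, -, -, -, -, hCK, -⟩ := B.bigConst_spec
  set n := Fintype.card (β ⊕ (γ ⊕ δ)) with hn
  set p : ℕ := (S₀ + 1) * T ^ B.dd with hp'
  set q : ℕ := (D' + 1) ^ n with hq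
  have hA1 := B.one_le_houseBound D' T S₀
  have hC1 := one_le_siegelConst B.K
  have hq1 : (1 : ℝ) ≤ q := by
    have : 1 ≤ q := Nat.one_le_iff_ne_zero.mpr (pow_ne_zero _ (Nat.succ_ne_zero _))
    exact_mod_cast this
  -- the exponent `t = p/(q - p) ∈ [0, 1]`
  have hqp' : (2 : ℝ) * p ≤ q := by exact_mod_cast hqp
  have hp0 : (0 : ℝ) < p := by exact_mod_cast hp
  set t : ℝ := (p : ℝ) / ((q : ℝ) - p) with ht
  have ht1 : t ≤ 1 := by rw [ht, div_le_one (by linarith)]; linarith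
  have hbase : 1 ≤ siegelConst B.K * q * B.houseBound D' T S₀ :=
    one_le_mul_of_one_le_of_one_le (one_le_mul_of_one_le_of_one_le hC1 hq1) hA1
  unfold siegelHouseBound
  rw [← hn, ← hp', ← hq]
  calc siegelConst B.K * (siegelConst B.K * (q : ℝ) * B.houseBound D' T S₀) ^ t
      ≤ siegelConst B.K * (siegelConst B.K * (q : ℝ) * B.houseBound D' T S₀) :=
        mul_le_mul_of_nonneg_left (BakerData.rpow_le_self_of_one_le hbase ht1) (zero_le_one.trans hC1)
    _ = siegelConst B.K ^ 2 * (q : ℝ) * B.houseBound D' T S₀ := by ring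
    _ ≤ B.bigConst ^ 2 * W ^ n * B.houseBound D' T S₀ := by
        have hqW : (q : ℝ) ≤ W ^ n := by
          rw [hq]; push_cast; exact pow_le_pow_left₀ (by positivity) hWD n
        have hCG : siegelConst B.K ^ 2 ≤ B.bigConst ^ 2 := pow_le_pow_left₀ (zero_le_one.trans hC1) hCK 2
        have : (0 : ℝ) ≤ B.bigConst ^ 2 := by positivity
        exact mul_le_mul_of_nonneg_right (mul_le_mul hCG hqW (by positivity) this) (zero_le_one.trans hA1)

variable [DecidableEq β] [DecidableEq δ]

/-- **Envelope of `H_ξ`** under the Siegel house bound on the coefficients: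
`H_ξ ≤ G³ · W^{2n} · A`. [folklore] -/
theorem houseXi_le {D' T S₀ : ℕ} (ξ : UIdx β γ δ D' → 𝓞 B.K)
    (hξ : ∀ u, house ((ξ u : 𝓞 B.K) : B.K) ≤ B.siegelHouseBound D' T S₀) {W : ℝ} (hW1 : 1 ≤ W)
    (hWD : (D' : ℝ) + 1 ≤ W) (hqp : 2 * ((S₀ + 1) * T ^ B.dd) ≤ (D' + 1) ^ Fintype.card (β ⊕ (γ ⊕ δ)))
    (hp : 0 < (S₀ + 1) * T ^ B.dd) :
    B.houseXi ξ ≤ B.bigConst ^ 3 * W ^ (2 * Fintype.card (β ⊕ (γ ⊕ δ))) * B.houseBound D' T S₀ := by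
  have hG2 := B.bigConst_spec.1
  set n := Fintype.card (β ⊕ (γ ⊕ δ)) with hn
  have hSHB := B.siegelHouseBound_le D' T S₀ hWD hqp hp
  rw [← hn] at hSHB
  have hA1 := B.one_le_houseBound D' T S₀
  have hU : (Fintype.card (UIdx β γ δ D') : ℝ) ≤ W ^ n := by
    rw [card_UIdx]; push_cast; exact pow_le_pow_left₀ (by positivity) hWD n
  unfold houseXi
  have hsum : ∑ u, house ((ξ u : 𝓞 B.K) : B.K) ≤ (Fintype.card (UIdx β γ δ D') : ℝ) * B.siegelHouseBound D' T S₀ := by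
    calc ∑ u, house ((ξ u : 𝓞 B.K) : B.K) ≤ ∑ _u : UIdx β γ δ D', B.siegelHouseBound D' T S₀ :=
          Finset.sum_le_sum fun u _ => hξ u
      _ = _ := by rw [Finset.sum_const, nsmul_eq_mul, Finset.card_univ]
  have hSHB0 : 0 ≤ B.siegelHouseBound D' T S₀ := (house_nonneg _).trans (hξ (fun _ => 0))
  have hWn : (1 : ℝ) ≤ W ^ n := one_le_pow₀ hW1
  have hX : 1 + (Fintype.card (UIdx β γ δ D') : ℝ) * B.siegelHouseBound D' T S₀ ≤
      W ^ n * (B.bigConst ^ 2 * W ^ n * B.houseBound D' T S₀) + W ^ n * (B.bigConst ^ 2 * W ^ n * B.houseBound D' T S₀) := by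
    have h1 : (1 : ℝ) ≤ W ^ n * (B.bigConst ^ 2 * W ^ n * B.houseBound D' T S₀) := by
      refine one_le_mul_of_one_le_of_one_le hWn (one_le_mul_of_one_le_of_one_le
        (one_le_mul_of_one_le_of_one_le (by nlinarith) hWn) hA1)
    have h2 : (Fintype.card (UIdx β γ δ D') : ℝ) * B.siegelHouseBound D' T S₀ ≤
        W ^ n * (B.bigConst ^ 2 * W ^ n * B.houseBound D' T S₀) :=
      mul_le_mul hU hSHB hSHB0 (by positivity)
    linarith
  calc 1 + ∑ u, house ((ξ u : 𝓞 B.K) : B.K) ≤ 1 + (Fintype.card (UIdx β γ δ D') : ℝ) * B.siegelHouseBound D' T S₀ := by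
        linarith
    _ ≤ 2 * (W ^ n * (B.bigConst ^ 2 * W ^ n * B.houseBound D' T S₀)) := by linarith
    _ ≤ B.bigConst * (W ^ n * (B.bigConst ^ 2 * W ^ n * B.houseBound D' T S₀)) :=
        mul_le_mul_of_nonneg_right hG2 (by positivity)
    _ = B.bigConst ^ 3 * W ^ (2 * n) * B.houseBound D' T S₀ := by ring

/-! ### Denominators, the order loss, the growth factor, the right-hand side -/

omit [DecidableEq β] [DecidableEq δ] in
/-- **Envelope of `|d_s|^E`**: `|d_s|^{E(D,k)} ≤ G^{(1 + #Gen·(S₁+1)³)·E(D,T')}` for `s ≤ S₁`, `k ≤ T'`.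
[folklore] -/
theorem dAt_pow_le {D S₁ T' s k : ℕ} (hs : s ≤ S₁) (hk : k ≤ T') :
    |(B.dAt s : ℝ)| ^ B.expE D k ≤ B.bigConst ^ ((1 + Fintype.card (Gen β γ δ) * (S₁ + 1) ^ 3) * B.expE D T') := by
  have hG1 := B.one_le_bigConst
  have h1 : |(B.dAt s : ℝ)| ≤ B.bigConst ^ (1 + Fintype.card (Gen β γ δ) * (S₁ + 1) ^ 3) :=
    ((B.abs_dAt_le_dB s).trans (B.dB_mono hs)).trans (B.dB_le_pow S₁)
  calc |(B.dAt s : ℝ)| ^ B.expE D k ≤ (B.bigConst ^ (1 + Fintype.card (Gen β γ δ) * (S₁ + 1) ^ 3)) ^ B.expE D k :=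
        pow_le_pow_left₀ (abs_nonneg _) h1 _
    _ ≤ (B.bigConst ^ (1 + Fintype.card (Gen β γ δ) * (S₁ + 1) ^ 3)) ^ B.expE D T' :=
        pow_le_pow_right₀ (one_le_pow₀ hG1) (B.expE_mono D hk)
    _ = _ := by rw [← pow_mul]

omit [DecidableEq β] [DecidableEq δ] in
/-- **Envelope of the order loss** `k!·(kX+1)^k ≤ (G·W)^{2T'}` for `k ≤ T' ≤ W`. [folklore] -/
theorem orderLoss_le {T' k : ℕ} (hk : k ≤ T') {W : ℝ} (hW1 : 1 ≤ W) (hWT : (T' : ℝ) ≤ W) :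
    (k.factorial : ℝ) * ((k : ℝ) * B.dirNorm + 1) ^ k ≤ (B.bigConst * W) ^ (2 * T') := by
  obtain ⟨hG2, -, -, -, -, -, -, -, -, -, hX, -⟩ := B.bigConst_spec
  have hX0 := B.dirNorm_nonneg
  have hG1 := B.one_le_bigConst
  have hGW1 : 1 ≤ B.bigConst * W := one_le_mul_of_one_le_of_one_le hG1 hW1
  have hkW : (k : ℝ) ≤ W := le_trans (by exact_mod_cast hk) hWT
  -- `k! ≤ k^k ≤ W^k`
  have h1 : (k.factorial : ℝ) ≤ W ^ k := by
    calc (k.factorial : ℝ) ≤ ((k ^ k : ℕ) : ℝ) := by exact_mod_cast Nat.factorial_le_pow k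
      _ = (k : ℝ) ^ k := by push_cast; ring
      _ ≤ W ^ k := pow_le_pow_left₀ (Nat.cast_nonneg _) hkW k
  -- `kX + 1 ≤ W·G`
  have h2 : (k : ℝ) * B.dirNorm + 1 ≤ B.bigConst * W := by
    have : (k : ℝ) * B.dirNorm + 1 ≤ W * (B.dirNorm + 1) := by nlinarith
    calc (k : ℝ) * B.dirNorm + 1 ≤ W * (B.dirNorm + 1) := this
      _ ≤ W * B.bigConst := mul_le_mul_of_nonneg_left hX (by linarith)
      _ = B.bigConst * W := mul_comm _ _
  calc (k.factorial : ℝ) * ((k : ℝ) * B.dirNorm + 1) ^ k ≤ W ^ k * (B.bigConst * W) ^ k :=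
        mul_le_mul h1 (pow_le_pow_left₀ (by positivity) h2 k) (by positivity) (by positivity)
    _ ≤ (B.bigConst * W) ^ k * (B.bigConst * W) ^ k := by
        refine mul_le_mul_of_nonneg_right (pow_le_pow_left₀ (by linarith) ?_ k) (by positivity)
        nlinarith
    _ = (B.bigConst * W) ^ (2 * k) := by rw [← pow_add]; ring_nf
    _ ≤ (B.bigConst * W) ^ (2 * T') := pow_le_pow_right₀ hGW1 (by omega)

omit [DecidableEq β] [DecidableEq δ] in
/-- **Envelope of the growth factor**: with `R ≤ R'` (`R' ∈ ℕ`), `e^{C_Θ D (1 + (R‖v‖+1)²)} ≤ G^{D(1 + (R'+1)² G'²)}`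
where `G ≤ G'` (`G' ∈ ℕ`). [folklore] -/
theorem growth_le (D : ℕ) {R : ℝ} (hR0 : 0 ≤ R) {R' G' : ℕ} (hR : R ≤ R') (hG' : B.bigConst ≤ G') :
    Real.exp (thetaGrowthC (β := β) B.L B.κM * (1 + (R * ‖B.v‖ + 1) ^ 2)) ^ D ≤
      B.bigConst ^ (D * (1 + (R' + 1) ^ 2 * G' ^ 2)) := by
  obtain ⟨hG2, -, -, -, -, -, -, hexp, -, -, -, hv⟩ := B.bigConst_spec
  have hC0 := (thetaGrowthC_spec (β := β) B.L B.κM).1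
  have hv0 : 0 ≤ ‖B.v‖ := norm_nonneg _
  have hin : R * ‖B.v‖ + 1 ≤ ((R' : ℝ) + 1) * B.bigConst := by
    have h1 : R * ‖B.v‖ + 1 ≤ (R + 1) * (‖B.v‖ + 1) := by nlinarith
    calc R * ‖B.v‖ + 1 ≤ (R + 1) * (‖B.v‖ + 1) := h1
      _ ≤ ((R' : ℝ) + 1) * B.bigConst := mul_le_mul (by linarith) hv (by positivity) (by positivity)
  have hsq : (R * ‖B.v‖ + 1) ^ 2 ≤ (((R' : ℝ) + 1) * G') ^ 2 := by
    refine pow_le_pow_left₀ (by positivity) (hin.trans ?_) 2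
    exact mul_le_mul_of_nonneg_left hG' (by positivity)
  have hy : 1 + (R * ‖B.v‖ + 1) ^ 2 ≤ ((1 + (R' + 1) ^ 2 * G' ^ 2 : ℕ) : ℝ) := by
    push_cast; nlinarith
  rw [← Real.exp_nat_mul]
  rw [show (D : ℝ) * (thetaGrowthC (β := β) B.L B.κM * (1 + (R * ‖B.v‖ + 1) ^ 2)) =
      thetaGrowthC (β := β) B.L B.κM * ((D : ℝ) * (1 + (R * ‖B.v‖ + 1) ^ 2)) from by ring]
  refine B.exp_mul_le_bigConst_pow hexp hC0 ?_
  push_cast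
  exact mul_le_mul_of_nonneg_left (by exact_mod_cast hy) (Nat.cast_nonneg D)

omit [DecidableEq β] [DecidableEq δ] in
/-- **Lower envelope of the right-hand side**: `G^{-D(1+(s+1)³)} ≤ (c_Θ e^{-C'_Θ(s+1)³})^D`. [folklore] -/
theorem rhs_ge (D s : ℕ) :
    (B.bigConst ^ (D * (1 + (s + 1) ^ 3)))⁻¹ ≤ (B.thetaLowc * Real.exp (-(B.thetaLowC * ((s : ℝ) + 1) ^ 3))) ^ D := by
  obtain ⟨hG2, -, -, -, -, -, -, -, hcinv, hCexp, -⟩ := B.bigConst_spec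
  obtain ⟨hc0, hC'0, -⟩ := B.thetaLow_spec
  have hG1 := B.one_le_bigConst
  have hG0 : 0 < B.bigConst := by linarith
  have h1 : B.bigConst⁻¹ ≤ B.thetaLowc := by
    rw [inv_le_comm₀ hG0 hc0]; exact hcinv
  have h2 : (B.bigConst ^ ((s + 1) ^ 3))⁻¹ ≤ Real.exp (-(B.thetaLowC * ((s : ℝ) + 1) ^ 3)) := by
    rw [Real.exp_neg, inv_le_inv₀ (by positivity) (Real.exp_pos _)]
    calc Real.exp (B.thetaLowC * ((s : ℝ) + 1) ^ 3) = Real.exp B.thetaLowC ^ ((s + 1) ^ 3) := by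
          rw [← Real.exp_nat_mul]; push_cast; ring_nf
      _ ≤ B.bigConst ^ ((s + 1) ^ 3) := pow_le_pow_left₀ (Real.exp_nonneg _) hCexp _
  calc (B.bigConst ^ (D * (1 + (s + 1) ^ 3)))⁻¹ = (B.bigConst⁻¹ * (B.bigConst ^ ((s + 1) ^ 3))⁻¹) ^ D := by
        rw [← mul_inv, ← pow_succ', inv_pow, ← pow_mul]
        congr 2; ring
    _ ≤ (B.thetaLowc * Real.exp (-(B.thetaLowC * ((s : ℝ) + 1) ^ 3))) ^ D :=
        pow_le_pow_left₀ (by positivity) (mul_le_mul h1 h2 (by positivity) hc0.le) D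

/-! ### The Liouville bound `Λ` and the saving factor -/

/-- **Envelope of `lineValBound`**: for `s ≤ S₁`, `k ≤ T'`, under the Siegel house bound,
`Λ_{s,k} ≤ G^{2T' + 3 + D + (S₁+1)³P₁} · W^{2T' + 3n} · A`, `P₁ = D·hdeg + 2T'`, `A = houseBound`.
[folklore] -/
theorem lineValBound_le {D' T S₀ S₁ T' : ℕ} (ξ : UIdx β γ δ D' → 𝓞 B.K)
    (hξ : ∀ u, house ((ξ u : 𝓞 B.K) : B.K) ≤ B.siegelHouseBound D' T S₀) {W : ℝ} (hW1 : 1 ≤ W)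
    (hWD : (D' : ℝ) + 1 ≤ W) (hqp : 2 * ((S₀ + 1) * T ^ B.dd) ≤ (D' + 1) ^ Fintype.card (β ⊕ (γ ⊕ δ)))
    (hp : 0 < (S₀ + 1) * T ^ B.dd) (hWT' : (T' : ℝ) ≤ W)
    (hWP : ((Fintype.card (β ⊕ (γ ⊕ δ)) * D' * B.hdeg : ℕ) : ℝ) + 2 * T' ≤ W)
    {s k : ℕ} (hs : s ≤ S₁) (hk : k ≤ T') :
    B.lineValBound ξ s k ≤
      B.bigConst ^ (2 * T' + 3 + Fintype.card (β ⊕ (γ ⊕ δ)) * D' +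
          (S₁ + 1) ^ 3 * (Fintype.card (β ⊕ (γ ⊕ δ)) * D' * B.hdeg + 2 * T')) *
        W ^ (2 * T' + 3 * Fintype.card (β ⊕ (γ ⊕ δ))) * B.houseBound D' T S₀ := by
  obtain ⟨hG2, -, hM, hhB, hqB, hdd, -⟩ := B.bigConst_spec
  have hG1 := B.one_le_bigConst
  have hG0 : (0 : ℝ) ≤ B.bigConst := by linarith
  have hW0 : (0 : ℝ) ≤ W := by linarith
  set n := Fintype.card (β ⊕ (γ ⊕ δ)) with hn
  set D := n * D' with hD
  set P₁ := D * B.hdeg + 2 * T' with hP₁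
  have hA1 := B.one_le_houseBound D' T S₀
  have hHξ := B.houseXi_le ξ hξ hW1 hWD hqp hp
  rw [← hn] at hHξ
  have hkW : (k : ℝ) ≤ W := le_trans (by exact_mod_cast hk) hWT'
  have hU : (Fintype.card (UIdx β γ δ D') : ℝ) ≤ W ^ n := by
    rw [card_UIdx]; push_cast; exact pow_le_pow_left₀ (by positivity) hWD n
  -- the factors
  have f1 : (B.dd : ℝ) ^ k ≤ B.bigConst ^ T' :=
    (pow_le_pow_left₀ (Nat.cast_nonneg _) (by linarith : (B.dd : ℝ) ≤ B.bigConst) k).trans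
      (pow_le_pow_right₀ hG1 hk)
  have f2 : (k : ℝ) ^ k ≤ W ^ T' := (pow_le_pow_left₀ (Nat.cast_nonneg _) hkW k).trans (pow_le_pow_right₀ hW1 hk)
  have f5 : (((D * B.hdeg : ℕ) : ℝ) + 2 * k) ^ k ≤ W ^ T' := by
    have : ((D * B.hdeg : ℕ) : ℝ) + 2 * k ≤ W := by
      have : (k : ℝ) ≤ T' := by exact_mod_cast hk
      rw [hD]; linarith
    exact (pow_le_pow_left₀ (by positivity) this k).trans (pow_le_pow_right₀ hW1 hk)
  have f6 : B.qB ^ k ≤ B.bigConst ^ T' :=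
    ((pow_le_pow_left₀ B.qB_nonneg ((le_max_right 1 B.qB).trans hqB) k)).trans (pow_le_pow_right₀ hG1 hk)
  have f7 : B.hB ^ D ≤ B.bigConst ^ D := pow_le_pow_left₀ (zero_le_one.trans B.one_le_hB) hhB _
  have hg1 := B.one_le_gBound s
  have hg0 : (0 : ℝ) ≤ B.gBound s := zero_le_one.trans hg1
  have hgs : B.gBound s ≤ B.bigConst ^ ((S₁ + 1) ^ 3) := (B.gBound_mono hs).trans (B.gBound_le_pow S₁)
  have f8 : B.gBound s ^ (D * B.hdeg + 2 * k) ≤ (B.bigConst ^ ((S₁ + 1) ^ 3)) ^ P₁ :=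
    (pow_le_pow_left₀ hg0 hgs _).trans (pow_le_pow_right₀ (one_le_pow₀ hG1) (by rw [hP₁]; omega))
  -- nonnegativity
  have n2 : (0 : ℝ) ≤ (k : ℝ) ^ k := by positivity
  have n3 : (0 : ℝ) ≤ (Fintype.card (UIdx β γ δ D') : ℝ) := Nat.cast_nonneg _
  have n4 : (0 : ℝ) ≤ B.houseXi ξ := zero_le_one.trans (B.one_le_houseXi ξ)
  have n6 : (0 : ℝ) ≤ B.qB ^ k := pow_nonneg B.qB_nonneg _
  have n7 : (0 : ℝ) ≤ B.hB ^ D := pow_nonneg (zero_le_one.trans B.one_le_hB) _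
  have n8 : (0 : ℝ) ≤ B.gBound s ^ (D * B.hdeg + 2 * k) := pow_nonneg hg0 _
  unfold lineValBound
  rw [← hn, ← hD]
  calc (B.dd : ℝ) ^ k * (k : ℝ) ^ k * (Fintype.card (UIdx β γ δ D') : ℝ) * B.houseXi ξ *
        ((((D * B.hdeg : ℕ) : ℝ) + 2 * k) ^ k * B.qB ^ k * B.hB ^ D * B.gBound s ^ (D * B.hdeg + 2 * k))
      ≤ B.bigConst ^ T' * W ^ T' * W ^ n * (B.bigConst ^ 3 * W ^ (2 * n) * B.houseBound D' T S₀) *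
          (W ^ T' * B.bigConst ^ T' * B.bigConst ^ D * (B.bigConst ^ ((S₁ + 1) ^ 3)) ^ P₁) := by
        refine mul_le_mul (mul_le_mul (mul_le_mul (mul_le_mul f1 f2 n2 (by positivity)) hU n3 (by positivity))
          hHξ n4 (by positivity)) (mul_le_mul (mul_le_mul (mul_le_mul f5 f6 n6 (by positivity)) f7 n7
          (by positivity)) f8 n8 (by positivity)) (by positivity) (by positivity)
    _ = B.bigConst ^ (2 * T' + 3 + D + (S₁ + 1) ^ 3 * P₁) * W ^ (2 * T' + 3 * n) * B.houseBound D' T S₀ := by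
        rw [← pow_mul]; ring


end BakerDataG

end Std

end GaGmE

end Literature.NumberTheory.Transcendental

end
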